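import Mathlib
import Literature.Analysis.FunctionSpaces.SobolevTracePoincareProofs

/-!
# Route LevelSetModeration — `HighSpeedPressureWork`: calculus on coordinate boxes

Support file for item stmt-NavierStokesRegularity-18149 (`HighSpeedPressureWork`), first layer of
the stopping-time estimate for the level-set pressure pairing (the early bookkeeping at exponent
`1/2`). Three elementary facts on coordinate boxes `[l, u] ⊆ ℝⁿ⁺¹ = Fin (n+1) → ℝ`, all for `C¹`
data (no traces, no Sobolev spaces):

* `levelSetModeration_box_divergence` — the divergence theorem for a `C¹` vector field on a box
  (Mathlib's `integral_divergence_of_hasFDerivAt_off_countable'`, no exceptional set);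
* `levelSetModeration_box_frontFace_le`, `levelSetModeration_box_backFace_le` — **face integrals
  of a `C¹` function are controlled by the box**:
  `∫_{xᵢ = uᵢ} K ≤ (uᵢ - lᵢ)⁻¹ ∫_{[l,u]} K + ∫_{[l,u]} |∂ᵢK|` (divergence theorem for the field
  `ℓ K eᵢ`, `ℓ = (xᵢ - lᵢ)/(uᵢ - lᵢ)`), and the same for the back face;
* `levelSetModeration_cube_poincare` — **Poincaré on a cube for functions vanishing on half of
  it**: if `K ∈ C¹` vanishes on a measurable `Z ⊆ Q`, `Q` a half-open cube of side `s` in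
  `ι → ℝ` with `|Q| ≤ 2|Z|`, then `∫_Q |K| ≤ 2^{d+1} s ∫_Q ‖DK‖` (`d = #ι`; the two-set estimate
  `lintegral_prod_enorm_sub_rpow_le_of_contDiff` of the tree, Maz'ya §1.1.10).
-/

noncomputable section

-- single-conjunct summit: `Summit.<Summit>.<Problem>` repeats the name by the D-0017 layout
set_option linter.dupNamespace false

namespace Summit.NavierStokesRegularity.NavierStokesRegularity.Theorems

open MeasureTheory Set Filter Topology Function
open scoped ENNReal NNReal

/-! ### The divergence theorem on a box for `C¹` fields -/

/-- **Divergence theorem on a box, `C¹` version**: for `W ∈ C¹(ℝⁿ⁺¹; ℝⁿ⁺¹)` and `l ≤ u`,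
`∫_{[l,u]} div W = Σᵢ (∫_{face i} Wᵢ(xᵢ = uᵢ) - ∫_{face i} Wᵢ(xᵢ = lᵢ))`, the faces being
parametrised by `Fin.insertNth i` over `[l ∘ succAbove i, u ∘ succAbove i]`. [folklore] -/
theorem levelSetModeration_box_divergence {n : ℕ} (l u : Fin (n + 1) → ℝ) (hlu : l ≤ u)
    (W : (Fin (n + 1) → ℝ) → (Fin (n + 1) → ℝ)) (hW : ContDiff ℝ 1 W) :
    ∫ x in Icc l u, ∑ i, fderiv ℝ W x (Pi.single i 1) i =
      ∑ i : Fin (n + 1),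
        ((∫ y in Icc (l ∘ i.succAbove) (u ∘ i.succAbove), W (i.insertNth (u i) y) i) -
          ∫ y in Icc (l ∘ i.succAbove) (u ∘ i.succAbove), W (i.insertNth (l i) y) i) := by
  have hWc : Continuous W := hW.continuous
  have hDW : Continuous (fderiv ℝ W) := hW.continuous_fderiv one_ne_zero
  have hdiff : ∀ x, HasFDerivAt W (fderiv ℝ W x) x := fun x =>
    ((hW.differentiable one_ne_zero) x).hasFDerivAt
  have hI : IntegrableOn (fun x => ∑ i, ((ContinuousLinearMap.proj (R := ℝ) i).comp (fderiv ℝ W x))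
      (Pi.single i 1)) (Icc l u) := by
    refine Continuous.integrableOn_Icc ?_
    refine continuous_finsetSum _ fun i _ => ?_
    simp only [ContinuousLinearMap.coe_comp, comp_apply, ContinuousLinearMap.proj_apply]
    exact (continuous_apply i).comp (hDW.clm_apply continuous_const)
  have key := integral_divergence_of_hasFDerivAt_off_countable' l u hlu (fun i x => W x i)
    (fun i x => (ContinuousLinearMap.proj i).comp (fderiv ℝ W x)) ∅ countable_empty
    (fun i => ((continuous_apply i).comp hWc).continuousOn)
    (fun x _ i => hasFDerivAt_pi'.1 (hdiff x) i) hI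
  simpa only [ContinuousLinearMap.coe_comp, comp_apply, ContinuousLinearMap.proj_apply] using key

/-! ### Face integrals are controlled by the box -/

section Face

variable {n : ℕ}

/-- The coordinate weight `ℓ(x) = (xᵢ - lᵢ)/(uᵢ - lᵢ)` has derivative `h ↦ hᵢ/(uᵢ - lᵢ)`. [folklore] -/
theorem levelSetModeration_hasFDerivAt_coordWeight (l u : Fin (n + 1) → ℝ) (i : Fin (n + 1))
    (x : Fin (n + 1) → ℝ) :
    HasFDerivAt (fun x : Fin (n + 1) → ℝ => (x i - l i) / (u i - l i))
      ((u i - l i)⁻¹ • ContinuousLinearMap.proj (R := ℝ) i) x := by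
  have h1 : HasFDerivAt (fun x : Fin (n + 1) → ℝ => x i - l i)
      (ContinuousLinearMap.proj (R := ℝ) i) x := (hasFDerivAt_apply i x).sub_const (l i)
  have h2 := h1.mul_const (u i - l i)⁻¹
  simp only [div_eq_mul_inv]
  convert h2 using 1

/-- **Front face bound**: for `K ∈ C¹(ℝⁿ⁺¹)` and a non-degenerate box `[l, u]`,
`∫_{face i} K(xᵢ = uᵢ) ≤ (uᵢ - lᵢ)⁻¹ ∫_{[l,u]} K + ∫_{[l,u]} |∂ᵢK|` (divergence theorem for the
field `ℓ K eᵢ`, `ℓ = (xᵢ - lᵢ)/(uᵢ - lᵢ)`, which equals `K` on the front face and `0` on the back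
face). [folklore] -/
theorem levelSetModeration_box_frontFace_le (l u : Fin (n + 1) → ℝ) (hlu : ∀ i, l i < u i)
    {K : (Fin (n + 1) → ℝ) → ℝ} (hK : ContDiff ℝ 1 K) (i : Fin (n + 1)) :
    ∫ y in Icc (l ∘ i.succAbove) (u ∘ i.succAbove), K (i.insertNth (u i) y) ≤
      (u i - l i)⁻¹ * (∫ x in Icc l u, K x) + ∫ x in Icc l u, |fderiv ℝ K x (Pi.single i 1)| := by
  have hle : l ≤ u := fun j => (hlu j).le
  have hh : 0 < u i - l i := sub_pos.2 (hlu i)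
  have hKc : Continuous K := hK.continuous
  have hDK : Continuous (fderiv ℝ K) := hK.continuous_fderiv one_ne_zero
  have hdK : ∀ x, HasFDerivAt K (fderiv ℝ K x) x := fun x =>
    ((hK.differentiable one_ne_zero) x).hasFDerivAt
  -- the weight and the field `f j = δ_{ij} ℓ K`
  set ℓ : (Fin (n + 1) → ℝ) → ℝ := fun x => (x i - l i) / (u i - l i) with hℓ
  have hℓc : Continuous ℓ :=
    ((continuous_apply i).sub continuous_const).div_const _
  set D : (Fin (n + 1) → ℝ) → (Fin (n + 1) → ℝ) →L[ℝ] ℝ := fun x =>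
    K x • ((u i - l i)⁻¹ • ContinuousLinearMap.proj (R := ℝ) i) + ℓ x • fderiv ℝ K x with hD
  have hprod : ∀ x, HasFDerivAt (fun x => ℓ x * K x) (D x) x := fun x =>
    ((levelSetModeration_hasFDerivAt_coordWeight l u i x).mul (hdK x)).congr_fderiv (add_comm _ _)
  set f : Fin (n + 1) → (Fin (n + 1) → ℝ) → ℝ := fun j x => if j = i then ℓ x * K x else 0 with hf
  set f' : Fin (n + 1) → (Fin (n + 1) → ℝ) → (Fin (n + 1) → ℝ) →L[ℝ] ℝ :=
    fun j x => if j = i then D x else 0 with hf'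
  have hfc : ∀ j, ContinuousOn (f j) (Icc l u) := fun j => by
    by_cases hj : j = i
    · simp only [hf, hj, if_true]; exact (hℓc.mul hKc).continuousOn
    · simp only [hf, hj, if_false]; exact continuousOn_const
  have hfd : ∀ x ∈ (Set.pi univ fun j => Ioo (l j) (u j)) \ ∅, ∀ j, HasFDerivAt (f j) (f' j x) x := by
    intro x _ j
    by_cases hj : j = i
    · simp only [hf, hf', hj, if_true]; exact hprod x
    · simp only [hf, hf', hj, if_false]; exact hasFDerivAt_const _ _
  -- the divergence `Σ_j f' j x (e j) = K x /(uᵢ-lᵢ) + ℓ x ∂ᵢK x`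
  have hdiv : ∀ x, ∑ j, f' j x (Pi.single j 1) =
      (u i - l i)⁻¹ * K x + ℓ x * fderiv ℝ K x (Pi.single i 1) := by
    intro x
    have h1 : ∑ j, f' j x (Pi.single j 1) = f' i x (Pi.single i 1) :=
      Fintype.sum_eq_single i fun j hj => by simp [hf', hj]
    rw [h1]
    simp only [hf', if_true, hD, add_apply, smul_apply,
      ContinuousLinearMap.proj_apply, Pi.single_eq_same, smul_eq_mul, mul_one]
    ring
  have hdivc : Continuous fun x => (u i - l i)⁻¹ * K x + ℓ x * fderiv ℝ K x (Pi.single i 1) :=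
    (continuous_const.mul hKc).add (hℓc.mul (hDK.clm_apply continuous_const))
  have hI : IntegrableOn (fun x => ∑ j, f' j x (Pi.single j 1)) (Icc l u) := by
    simp_rw [hdiv]; exact hdivc.integrableOn_Icc
  have key := integral_divergence_of_hasFDerivAt_off_countable' l u hle f f' ∅ countable_empty hfc hfd hI
  simp_rw [hdiv] at key
  -- the face terms: only `j = i` survives; front weight `1`, back weight `0`
  have hfront : ∀ y, f i (i.insertNth (u i) y) = K (i.insertNth (u i) y) := fun y => by
    simp only [hf, if_true, hℓ, Fin.insertNth_apply_same, div_self hh.ne', one_mul]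
  have hback : ∀ y, f i (i.insertNth (l i) y) = 0 := fun y => by
    simp only [hf, if_true, hℓ, Fin.insertNth_apply_same, sub_self, zero_div, zero_mul]
  have hsum : ∑ j : Fin (n + 1), ((∫ y in Icc (l ∘ j.succAbove) (u ∘ j.succAbove), f j (j.insertNth (u j) y)) -
      ∫ y in Icc (l ∘ j.succAbove) (u ∘ j.succAbove), f j (j.insertNth (l j) y)) =
      ∫ y in Icc (l ∘ i.succAbove) (u ∘ i.succAbove), K (i.insertNth (u i) y) := by
    have h1 := Fintype.sum_eq_single (f := fun j : Fin (n + 1) =>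
      (∫ y in Icc (l ∘ j.succAbove) (u ∘ j.succAbove), f j (j.insertNth (u j) y)) -
        ∫ y in Icc (l ∘ j.succAbove) (u ∘ j.succAbove), f j (j.insertNth (l j) y)) i
      fun j hj => by simp [hf, hj]
    rw [h1]
    simp_rw [hfront, hback]
    simp
  rw [hsum] at key
  rw [← key]
  -- bound the divergence integral
  have hℓ01 : ∀ x ∈ Icc l u, 0 ≤ ℓ x ∧ ℓ x ≤ 1 := fun x hx => by
    have h1 : l i ≤ x i := hx.1 i
    have h2 : x i ≤ u i := hx.2 i
    refine ⟨div_nonneg (by linarith) hh.le, ?_⟩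
    rw [div_le_one hh]; linarith
  have hi1 : IntegrableOn (fun x => (u i - l i)⁻¹ * K x) (Icc l u) :=
    (continuous_const.mul hKc).integrableOn_Icc
  have hi2 : IntegrableOn (fun x => ℓ x * fderiv ℝ K x (Pi.single i 1)) (Icc l u) :=
    (hℓc.mul (hDK.clm_apply continuous_const)).integrableOn_Icc
  rw [integral_add hi1 hi2, integral_const_mul]
  refine add_le_add le_rfl ?_
  refine setIntegral_mono_on hi2 ((hDK.clm_apply continuous_const).abs.integrableOn_Icc)
    measurableSet_Icc fun x hx => ?_
  calc ℓ x * fderiv ℝ K x (Pi.single i 1) ≤ |ℓ x * fderiv ℝ K x (Pi.single i 1)| := le_abs_self _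
    _ = |ℓ x| * |fderiv ℝ K x (Pi.single i 1)| := abs_mul _ _
    _ ≤ 1 * |fderiv ℝ K x (Pi.single i 1)| := by
        gcongr; rw [abs_of_nonneg (hℓ01 x hx).1]; exact (hℓ01 x hx).2
    _ = |fderiv ℝ K x (Pi.single i 1)| := one_mul _

/-- **Back face bound**: for `K ∈ C¹(ℝⁿ⁺¹)` and a non-degenerate box `[l, u]`,
`∫_{face i} K(xᵢ = lᵢ) ≤ (uᵢ - lᵢ)⁻¹ ∫_{[l,u]} K + ∫_{[l,u]} |∂ᵢK|` (divergence theorem for the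
field `ℓ' K eᵢ`, `ℓ' = (uᵢ - xᵢ)/(uᵢ - lᵢ)`). [folklore] -/
theorem levelSetModeration_box_backFace_le (l u : Fin (n + 1) → ℝ) (hlu : ∀ i, l i < u i)
    {K : (Fin (n + 1) → ℝ) → ℝ} (hK : ContDiff ℝ 1 K) (i : Fin (n + 1)) :
    ∫ y in Icc (l ∘ i.succAbove) (u ∘ i.succAbove), K (i.insertNth (l i) y) ≤
      (u i - l i)⁻¹ * (∫ x in Icc l u, K x) + ∫ x in Icc l u, |fderiv ℝ K x (Pi.single i 1)| := by
  have hle : l ≤ u := fun j => (hlu j).le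
  have hh : 0 < u i - l i := sub_pos.2 (hlu i)
  have hKc : Continuous K := hK.continuous
  have hDK : Continuous (fderiv ℝ K) := hK.continuous_fderiv one_ne_zero
  have hdK : ∀ x, HasFDerivAt K (fderiv ℝ K x) x := fun x =>
    ((hK.differentiable one_ne_zero) x).hasFDerivAt
  -- the weight `ℓ' = 1 - ℓ` and the field `f j = δ_{ij} ℓ' K`
  set ℓ : (Fin (n + 1) → ℝ) → ℝ := fun x => (x i - l i) / (u i - l i) with hℓ
  have hℓc : Continuous ℓ :=
    ((continuous_apply i).sub continuous_const).div_const _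
  set D : (Fin (n + 1) → ℝ) → (Fin (n + 1) → ℝ) →L[ℝ] ℝ := fun x =>
    K x • (-((u i - l i)⁻¹ • ContinuousLinearMap.proj (R := ℝ) i)) + (1 - ℓ x) • fderiv ℝ K x with hD
  have hprod : ∀ x, HasFDerivAt (fun x => (1 - ℓ x) * K x) (D x) x := fun x => by
    have hw : HasFDerivAt (fun x => 1 - ℓ x) (-((u i - l i)⁻¹ • ContinuousLinearMap.proj (R := ℝ) i)) x :=
      (levelSetModeration_hasFDerivAt_coordWeight l u i x).const_sub 1
    exact (hw.mul (hdK x)).congr_fderiv (add_comm _ _)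
  set f : Fin (n + 1) → (Fin (n + 1) → ℝ) → ℝ := fun j x => if j = i then (1 - ℓ x) * K x else 0 with hf
  set f' : Fin (n + 1) → (Fin (n + 1) → ℝ) → (Fin (n + 1) → ℝ) →L[ℝ] ℝ :=
    fun j x => if j = i then D x else 0 with hf'
  have hfc : ∀ j, ContinuousOn (f j) (Icc l u) := fun j => by
    by_cases hj : j = i
    · simp only [hf, hj, if_true]; exact ((continuous_const.sub hℓc).mul hKc).continuousOn
    · simp only [hf, hj, if_false]; exact continuousOn_const
  have hfd : ∀ x ∈ (Set.pi univ fun j => Ioo (l j) (u j)) \ ∅, ∀ j, HasFDerivAt (f j) (f' j x) x := by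
    intro x _ j
    by_cases hj : j = i
    · simp only [hf, hf', hj, if_true]; exact hprod x
    · simp only [hf, hf', hj, if_false]; exact hasFDerivAt_const _ _
  have hdiv : ∀ x, ∑ j, f' j x (Pi.single j 1) =
      -((u i - l i)⁻¹ * K x) + (1 - ℓ x) * fderiv ℝ K x (Pi.single i 1) := by
    intro x
    have h1 : ∑ j, f' j x (Pi.single j 1) = f' i x (Pi.single i 1) :=
      Fintype.sum_eq_single i fun j hj => by simp [hf', hj]
    rw [h1]
    simp only [hf', if_true, hD, add_apply, smul_apply,
      neg_apply, ContinuousLinearMap.proj_apply, Pi.single_eq_same, smul_eq_mul,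
      mul_one]
    ring
  have hdivc : Continuous fun x => -((u i - l i)⁻¹ * K x) + (1 - ℓ x) * fderiv ℝ K x (Pi.single i 1) :=
    (continuous_const.mul hKc).neg.add ((continuous_const.sub hℓc).mul (hDK.clm_apply continuous_const))
  have hI : IntegrableOn (fun x => ∑ j, f' j x (Pi.single j 1)) (Icc l u) := by
    simp_rw [hdiv]; exact hdivc.integrableOn_Icc
  have key := integral_divergence_of_hasFDerivAt_off_countable' l u hle f f' ∅ countable_empty hfc hfd hI
  simp_rw [hdiv] at key
  have hfront : ∀ y, f i (i.insertNth (u i) y) = 0 := fun y => by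
    simp only [hf, if_true, hℓ, Fin.insertNth_apply_same, div_self hh.ne', sub_self, zero_mul]
  have hback : ∀ y, f i (i.insertNth (l i) y) = K (i.insertNth (l i) y) := fun y => by
    simp only [hf, if_true, hℓ, Fin.insertNth_apply_same, sub_self, zero_div, sub_zero, one_mul]
  have hsum : ∑ j : Fin (n + 1), ((∫ y in Icc (l ∘ j.succAbove) (u ∘ j.succAbove), f j (j.insertNth (u j) y)) -
      ∫ y in Icc (l ∘ j.succAbove) (u ∘ j.succAbove), f j (j.insertNth (l j) y)) =
      -∫ y in Icc (l ∘ i.succAbove) (u ∘ i.succAbove), K (i.insertNth (l i) y) := by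
    have h1 := Fintype.sum_eq_single (f := fun j : Fin (n + 1) =>
      (∫ y in Icc (l ∘ j.succAbove) (u ∘ j.succAbove), f j (j.insertNth (u j) y)) -
        ∫ y in Icc (l ∘ j.succAbove) (u ∘ j.succAbove), f j (j.insertNth (l j) y)) i
      fun j hj => by simp [hf, hj]
    rw [h1]
    simp_rw [hfront, hback]
    simp
  rw [hsum] at key
  have hℓ01 : ∀ x ∈ Icc l u, 0 ≤ 1 - ℓ x ∧ 1 - ℓ x ≤ 1 := fun x hx => by
    have h1 : l i ≤ x i := hx.1 i
    have h2 : x i ≤ u i := hx.2 i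
    have hℓ0 : 0 ≤ ℓ x := div_nonneg (by linarith) hh.le
    have hℓ1 : ℓ x ≤ 1 := by show (x i - l i) / (u i - l i) ≤ 1; rw [div_le_one hh]; linarith
    exact ⟨by linarith, by linarith⟩
  have hi1 : IntegrableOn (fun x => -((u i - l i)⁻¹ * K x)) (Icc l u) :=
    (continuous_const.mul hKc).neg.integrableOn_Icc
  have hi2 : IntegrableOn (fun x => (1 - ℓ x) * fderiv ℝ K x (Pi.single i 1)) (Icc l u) :=
    ((continuous_const.sub hℓc).mul (hDK.clm_apply continuous_const)).integrableOn_Icc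
  rw [integral_add hi1 hi2, integral_neg, integral_const_mul] at key
  -- `∫_{back} K = (uᵢ-lᵢ)⁻¹ ∫ K - ∫ (1-ℓ) ∂ᵢK`
  have hval : ∫ y in Icc (l ∘ i.succAbove) (u ∘ i.succAbove), K (i.insertNth (l i) y) =
      (u i - l i)⁻¹ * (∫ x in Icc l u, K x) - ∫ x in Icc l u, (1 - ℓ x) * fderiv ℝ K x (Pi.single i 1) := by
    linarith
  rw [hval]
  have hbd : -(∫ x in Icc l u, (1 - ℓ x) * fderiv ℝ K x (Pi.single i 1)) ≤
      ∫ x in Icc l u, |fderiv ℝ K x (Pi.single i 1)| := by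
    rw [← integral_neg]
    refine setIntegral_mono_on hi2.neg ((hDK.clm_apply continuous_const).abs.integrableOn_Icc)
      measurableSet_Icc fun x hx => ?_
    calc -((1 - ℓ x) * fderiv ℝ K x (Pi.single i 1)) ≤ |(1 - ℓ x) * fderiv ℝ K x (Pi.single i 1)| :=
          neg_le_abs _
      _ = |1 - ℓ x| * |fderiv ℝ K x (Pi.single i 1)| := abs_mul _ _
      _ ≤ 1 * |fderiv ℝ K x (Pi.single i 1)| := by
          gcongr; rw [abs_of_nonneg (hℓ01 x hx).1]; exact (hℓ01 x hx).2
      _ = |fderiv ℝ K x (Pi.single i 1)| := one_mul _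
  linarith

end Face

/-! ### Poincaré on a cube for functions vanishing on half of it -/

/-- **Poincaré inequality on a half-open cube for `C¹` functions vanishing on half of the cube**:
for `K ∈ C¹(ι → ℝ; ℝ)` vanishing on a measurable `Z ⊆ Q = ∏ᵢ [lᵢ, lᵢ + s)` with `|Q| ≤ 2|Z|`,
`∫_Q |K| ≤ 2^{d+1} s ∫_Q ‖DK‖`, `d = #ι` (average the two-point estimate
`∫_{Q×Z} |K x - K y| ≤ s 2^d |Q| ∫_Q ‖DK‖` of Maz'ya §1.1.10 / Gilbarg–Trudinger Lemma 7.16 over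
the zero set). [cite: Mazja1985, §1.1.10 Theorem 1] -/
theorem levelSetModeration_cube_poincare {ι : Type*} [Fintype ι] (l : ι → ℝ) {s : ℝ} (hs : 0 < s)
    {K : (ι → ℝ) → ℝ} (hK : ContDiff ℝ 1 K) {Z : Set (ι → ℝ)} (hZm : MeasurableSet Z)
    (hZQ : Z ⊆ Set.pi univ fun i => Ico (l i) (l i + s))
    (hvol : volume (Set.pi univ fun i => Ico (l i) (l i + s)) ≤ 2 * volume Z)
    (hKZ : ∀ x ∈ Z, K x = 0) :
    ∫⁻ x in Set.pi univ (fun i => Ico (l i) (l i + s)), ‖K x‖ₑ ≤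
      ENNReal.ofReal (2 ^ (Fintype.card ι + 1) * s) *
        ∫⁻ x in Set.pi univ (fun i => Ico (l i) (l i + s)), ‖fderiv ℝ K x‖ₑ := by
  set Q : Set (ι → ℝ) := Set.pi univ fun i => Ico (l i) (l i + s) with hQ
  have hQm : MeasurableSet Q := MeasurableSet.univ_pi fun i => measurableSet_Ico
  -- geometry of the cube: convexity and diameter `≤ s` in the sup norm
  have hQconv : Convex ℝ Q := convex_pi fun i _ => convex_Ico _ _
  have hseg : ∀ x ∈ Q, ∀ y ∈ Z, segment ℝ x y ⊆ Q := fun x hx y hy =>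
    hQconv.segment_subset hx (hZQ hy)
  have hdist : ∀ x ∈ Q, ∀ y ∈ Z, ‖y - x‖ ≤ s := by
    intro x hx y hy
    have hy' := hZQ hy
    rw [pi_norm_le_iff_of_nonneg hs.le]
    intro i
    have hxi := (mem_univ_pi.1 hx) i
    have hyi := (mem_univ_pi.1 hy') i
    rw [Real.norm_eq_abs, abs_le]
    simp only [Pi.sub_apply]
    constructor <;> linarith [hxi.1, hxi.2, hyi.1, hyi.2]
  -- volumes
  have hvolQ : volume Q = ENNReal.ofReal (s ^ Fintype.card ι) := by
    rw [hQ, volume_pi, Measure.pi_pi]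
    simp only [Real.volume_Ico, add_sub_cancel_left, Finset.prod_const, Finset.card_univ]
    rw [ENNReal.ofReal_pow hs.le]
  have hvolQ_top : volume Q ≠ ∞ := by rw [hvolQ]; exact ENNReal.ofReal_ne_top
  have hvolQ_pos : volume Q ≠ 0 := by rw [hvolQ]; exact (ENNReal.ofReal_pos.2 (pow_pos hs _)).ne'
  have hZpos : volume Z ≠ 0 := by
    intro h0; rw [h0, mul_zero] at hvol; exact hvolQ_pos (nonpos_iff_eq_zero.1 hvol)
  have hZtop : volume Z ≠ ∞ := ne_top_of_le_ne_top hvolQ_top (measure_mono hZQ)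
  -- the two-set estimate with `q = 1`
  have key := Literature.Analysis.FunctionSpaces.lintegral_prod_enorm_sub_rpow_le_of_contDiff
    (μ := (volume : Measure (ι → ℝ))) hK hQm hZm hZQ hseg hdist (q := 1) le_rfl
  simp only [ENNReal.rpow_one] at key
  -- the left-hand side is `|Z| ∫_Q ‖K‖ₑ`
  have hLHS : ∫⁻ z, ‖K z.1 - K z.2‖ₑ ∂((volume.restrict Q).prod (volume.restrict Z)) =
      volume Z * ∫⁻ x in Q, ‖K x‖ₑ := by
    have hmeas : Measurable fun z : (ι → ℝ) × (ι → ℝ) => ‖K z.1 - K z.2‖ₑ :=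
      ((hK.continuous.comp continuous_fst).sub (hK.continuous.comp continuous_snd)).measurable.enorm
    rw [lintegral_prod _ hmeas.aemeasurable]
    have hinner : ∀ x, ∫⁻ y in Z, ‖K x - K y‖ₑ = ‖K x‖ₑ * volume Z := fun x => by
      rw [← lintegral_indicator hZm]
      have : Z.indicator (fun y => ‖K x - K y‖ₑ) = Z.indicator (fun _ => ‖K x‖ₑ) := by
        refine indicator_congr fun y hy => ?_
        rw [hKZ y hy, sub_zero]
      rw [this, lintegral_indicator_const hZm]
    simp_rw [hinner]
    rw [lintegral_mul_const _ hK.continuous.measurable.enorm, mul_comm]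
  rw [hLHS] at key
  -- divide by `|Z|`
  have hfin : volume Z * ∫⁻ x in Q, ‖K x‖ₑ ≤
      volume Z * (ENNReal.ofReal (2 ^ (Fintype.card ι + 1) * s) * ∫⁻ x in Q, ‖fderiv ℝ K x‖ₑ) := by
    refine key.trans ?_
    have hd : (Module.finrank ℝ (ι → ℝ)) = Fintype.card ι := Module.finrank_fintype_fun_eq_card ℝ
    rw [hd]
    calc ENNReal.ofReal s * 2 ^ Fintype.card ι * volume Q * ∫⁻ x in Q, ‖fderiv ℝ K x‖ₑ
        ≤ ENNReal.ofReal s * 2 ^ Fintype.card ι * (2 * volume Z) * ∫⁻ x in Q, ‖fderiv ℝ K x‖ₑ := by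
          gcongr
      _ = volume Z * (ENNReal.ofReal (2 ^ (Fintype.card ι + 1) * s) * ∫⁻ x in Q, ‖fderiv ℝ K x‖ₑ) := by
          rw [ENNReal.ofReal_mul (by positivity), ENNReal.ofReal_pow zero_le_two, ENNReal.ofReal_ofNat,
            pow_succ]
          ring
  exact (ENNReal.mul_le_mul_iff_right hZpos hZtop).1 hfin

end Summit.NavierStokesRegularity.NavierStokesRegularity.Theorems

end
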